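import Mathlib

/-!
# T5IdentityPrincipleGlobal — the identity principle on a connected charted space

Tier-5 support of seat p6 (Hodge-theoretic side of N1, cell pub-hodge-repro2): the passage
«from one chart to the connected manifold `S_j`» of memo H6 (route/T5-N1-hodge-p6.md), i.e. the
sentence «a holomorphic section of a line bundle on a connected manifold is zero iff it vanishes
on a non-empty open set», which the chart-level file leaves as honest scope.

Set-up (Mathlib's `ChartedSpace`): `X` a topological space with an atlas of charts
`chartAt E x : OpenPartialHomeomorph X E` into a normed space `E` over a complete
non-trivially normed field `𝕜` (for `S_j`: `𝕜 = ℂ`, `E = ℂ²`, the holomorphic atlas); a function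
`f : X → F` is *chart-analytic* if `f ∘ (chartAt E x).symm` is analytic on every chart target.
For the coefficient of `ω_{ab}` in a local trivialisation of `Ω²` this is holomorphy; the
vanishing locus of the coefficient does not depend on the trivialisation (transition functions
are units), which is why a scalar function suffices for the statement about zeros.

Main results: on a connected `X` whose chart targets are connected (balls),
* `eq_zero_of_eventually_zero`: chart-analytic `f` vanishing on a neighbourhood of ONE point
  vanishes identically;
* `exists_ne_zero_iff_dense`: `f ≠ 0` somewhere ⟺ `{x | f x ≠ 0}` is dense (and it is open:
  `isOpen_ne_zero`).

The proof is the clopen argument: the set of points near which `f` vanishes is open (trivially)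
and closed (a limit point lies in some chart, the chart meets the set, and Mathlib's
`AnalyticOnNhd.eqOn_zero_of_preconnected_of_eventuallyEq_zero` spreads the vanishing over the
whole chart), hence everything or nothing.  Nothing here is automorphic.
-/

namespace Summit.Ventures.HodgeRepro2.T5IdentityPrincipleGlobal

open Set Filter Topology

variable {𝕜 : Type*} [NontriviallyNormedField 𝕜]
  {E : Type*} [NormedAddCommGroup E] [NormedSpace 𝕜 E]
  {F : Type*} [NormedAddCommGroup F] [NormedSpace 𝕜 F]
  {X : Type*} [TopologicalSpace X]

/-- The points near which `f` vanishes identically. -/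
def locallyZero (f : X → F) : Set X := {x | ∀ᶠ y in 𝓝 x, f y = 0}

/-- Membership in `locallyZero`, unfolded. -/
theorem mem_locallyZero {f : X → F} {x : X} : x ∈ locallyZero f ↔ ∀ᶠ y in 𝓝 x, f y = 0 :=
  Iff.rfl

/-- `locallyZero f` is open (Mathlib `isOpen_setOf_eventually_nhds`). -/
theorem isOpen_locallyZero (f : X → F) : IsOpen (locallyZero f) :=
  isOpen_setOf_eventually_nhds

/-- A point of `locallyZero f` is a zero of `f`. -/
theorem eq_zero_of_mem_locallyZero {f : X → F} {x : X} (hx : x ∈ locallyZero f) : f x = 0 :=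
  (mem_locallyZero.mp hx).self_of_nhds

/-- A non-empty open set on which `f` vanishes is contained in `locallyZero f`. -/
theorem subset_locallyZero_of_eqOn {f : X → F} {V : Set X} (hV : IsOpen V)
    (hfV : EqOn f 0 V) : V ⊆ locallyZero f := by
  intro x hx
  rw [mem_locallyZero]
  filter_upwards [hV.mem_nhds hx] with y hy using hfV hy

section Chart

variable (e : OpenPartialHomeomorph X E)

/-- **The identity principle on one chart.** If `f ∘ e.symm` is analytic on the (pre)connected
target of the chart `e` and `f` vanishes near a point `x` of the chart's source, then `f` vanishes
on the whole source of `e` (transport of Mathlib's identity principle through the chart). -/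
theorem eqOn_zero_source_of_eventuallyEq_zero {f : X → F} (hconn : IsPreconnected e.target)
    (hf : AnalyticOnNhd 𝕜 (f ∘ e.symm) e.target) {x : X} (hx : x ∈ e.source)
    (h : ∀ᶠ y in 𝓝 x, f y = 0) : EqOn f 0 e.source := by
  have hx' : e x ∈ e.target := e.map_source hx
  have h1 : (f ∘ e.symm) =ᶠ[𝓝 (e x)] 0 := by
    have hc : ContinuousAt e.symm (e x) := e.continuousAt_symm hx'
    have h' : ∀ᶠ y in 𝓝 (e.symm (e x)), f y = 0 := by rwa [e.left_inv hx]
    filter_upwards [hc.eventually h'] with y hy using hy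
  have h2 : EqOn (f ∘ e.symm) 0 e.target :=
    hf.eqOn_zero_of_preconnected_of_eventuallyEq_zero hconn hx' h1
  intro z hz
  have h3 := h2 (e.map_source hz)
  simpa [e.left_inv hz] using h3

/-- The source of a chart on which `f` vanishes near ONE of its points lies in `locallyZero f`. -/
theorem source_subset_locallyZero {f : X → F} (hconn : IsPreconnected e.target)
    (hf : AnalyticOnNhd 𝕜 (f ∘ e.symm) e.target) {x : X} (hx : x ∈ e.source)
    (h : ∀ᶠ y in 𝓝 x, f y = 0) : e.source ⊆ locallyZero f :=
  subset_locallyZero_of_eqOn e.open_source (eqOn_zero_source_of_eventuallyEq_zero e hconn hf hx h)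

/-- A chart-analytic function is continuous at every point of the chart's source. -/
theorem continuousAt_of_analyticOnNhd_comp_symm {f : X → F}
    (hf : AnalyticOnNhd 𝕜 (f ∘ e.symm) e.target) {x : X} (hx : x ∈ e.source) :
    ContinuousAt f x := by
  have hx' : e x ∈ e.target := e.map_source hx
  have h1 : ContinuousAt ((f ∘ e.symm) ∘ e) x :=
    (hf (e x) hx').continuousAt.comp (e.continuousAt hx)
  refine h1.congr ?_
  filter_upwards [e.open_source.mem_nhds hx] with y hy
  simp [e.left_inv hy]

end Chart

section Global

variable [ChartedSpace E X]

/-!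
Hypotheses used below (kept inline, not packaged as definitions):
* `hX : ∀ x : X, IsPreconnected (chartAt E x).target` — the chart targets are connected
  (an atlas of balls);
* `hf : ∀ x : X, AnalyticOnNhd 𝕜 (f ∘ (chartAt E x).symm) (chartAt E x).target` — `f` is
  analytic in every preferred chart ("chart-analytic"; holomorphy for `𝕜 = ℂ`).
-/

/-- A chart-analytic function is continuous. -/
theorem continuous_of_forall_chart {f : X → F}
    (hf : ∀ x : X, AnalyticOnNhd 𝕜 (f ∘ (chartAt E x).symm) (chartAt E x).target) :
    Continuous f := by
  rw [continuous_iff_continuousAt]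
  intro x
  exact continuousAt_of_analyticOnNhd_comp_symm (chartAt E x) (hf x) (mem_chart_source E x)

/-- The non-vanishing set of a chart-analytic function is open (the "open" half of H6 (iv)). -/
theorem isOpen_ne_zero {f : X → F}
    (hf : ∀ x : X, AnalyticOnNhd 𝕜 (f ∘ (chartAt E x).symm) (chartAt E x).target) :
    IsOpen {x | f x ≠ 0} :=
  isOpen_ne_fun (continuous_of_forall_chart hf) continuous_const

/-- `locallyZero f` is closed when `f` is chart-analytic and the chart targets are connected:
a limit point of `locallyZero f` lies in a chart which meets `locallyZero f`, and the chart-level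
identity principle spreads the vanishing over that chart. -/
theorem isClosed_locallyZero (hX : ∀ x : X, IsPreconnected (chartAt E x).target) {f : X → F}
    (hf : ∀ x : X, AnalyticOnNhd 𝕜 (f ∘ (chartAt E x).symm) (chartAt E x).target) :
    IsClosed (locallyZero f) := by
  rw [← closure_subset_iff_isClosed]
  intro x hx
  have hxs : x ∈ (chartAt E x).source := mem_chart_source E x
  obtain ⟨t, hts, ht⟩ :=
    (mem_closure_iff_nhds.mp hx) (chartAt E x).source ((chartAt E x).open_source.mem_nhds hxs)
  exact source_subset_locallyZero (chartAt E x) (hX x) (hf x) hts (mem_locallyZero.mp ht) hxs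

/-- **The identity principle on a connected charted space.** A chart-analytic function on a
connected space with connected chart targets which vanishes on a neighbourhood of one point
vanishes identically (the clopen argument). -/
theorem eq_zero_of_eventually_zero [PreconnectedSpace X]
    (hX : ∀ x : X, IsPreconnected (chartAt E x).target) {f : X → F}
    (hf : ∀ x : X, AnalyticOnNhd 𝕜 (f ∘ (chartAt E x).symm) (chartAt E x).target)
    {x₀ : X} (h₀ : ∀ᶠ y in 𝓝 x₀, f y = 0) : ∀ x, f x = 0 := by
  have hcl : IsClopen (locallyZero f) := ⟨isClosed_locallyZero hX hf, isOpen_locallyZero f⟩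
  have huniv : locallyZero f = univ := hcl.eq_univ ⟨x₀, mem_locallyZero.mpr h₀⟩
  intro x
  exact eq_zero_of_mem_locallyZero (huniv ▸ mem_univ x)

/-- The same with the hypothesis «vanishes on a non-empty open set». -/
theorem eq_zero_of_eqOn_zero_open [PreconnectedSpace X]
    (hX : ∀ x : X, IsPreconnected (chartAt E x).target) {f : X → F}
    (hf : ∀ x : X, AnalyticOnNhd 𝕜 (f ∘ (chartAt E x).symm) (chartAt E x).target)
    {V : Set X} (hV : IsOpen V) (hne : V.Nonempty) (hfV : EqOn f 0 V) : ∀ x, f x = 0 := by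
  obtain ⟨v, hv⟩ := hne
  exact eq_zero_of_eventually_zero hX hf (mem_locallyZero.mp (subset_locallyZero_of_eqOn hV hfV hv))

/-- **H6 (i) ⟺ (iv) on the connected space.** A chart-analytic function on a non-empty connected
space with connected chart targets is non-zero somewhere iff its (open) non-vanishing set is
dense. -/
theorem exists_ne_zero_iff_dense [PreconnectedSpace X] [Nonempty X]
    (hX : ∀ x : X, IsPreconnected (chartAt E x).target) {f : X → F}
    (hf : ∀ x : X, AnalyticOnNhd 𝕜 (f ∘ (chartAt E x).symm) (chartAt E x).target) :
    (∃ x, f x ≠ 0) ↔ Dense {x | f x ≠ 0} := by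
  constructor
  · rintro ⟨x₀, hx₀⟩
    rw [dense_iff_inter_open]
    intro V hV hne
    by_contra hempty
    have hfV : EqOn f 0 V := by
      intro v hv
      by_contra hfv
      exact hempty ⟨v, hv, hfv⟩
    exact hx₀ (eq_zero_of_eqOn_zero_open hX hf hV hne hfV x₀)
  · intro hd
    obtain ⟨x, hx⟩ := hd.nonempty
    exact ⟨x, hx⟩

/-- The contrapositive form used in H6's «if `f_a` is constant on `S_j` then `ω_{ab}|_{S_j} = 0`»:
a chart-analytic function whose non-vanishing set is not dense vanishes identically. -/
theorem eq_zero_of_not_dense [PreconnectedSpace X] [Nonempty X]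
    (hX : ∀ x : X, IsPreconnected (chartAt E x).target) {f : X → F}
    (hf : ∀ x : X, AnalyticOnNhd 𝕜 (f ∘ (chartAt E x).symm) (chartAt E x).target)
    (h : ¬ Dense {x | f x ≠ 0}) : ∀ x, f x = 0 := by
  intro x
  by_contra hx
  exact h ((exists_ne_zero_iff_dense hX hf).mp ⟨x, hx⟩)

end Global

end Summit.Ventures.HodgeRepro2.T5IdentityPrincipleGlobal

/-!
## v2 (append-only): the connectedness hypothesis on the chart targets removed

The theorems above assume that every chart target is connected (an atlas of balls). For a
locally connected model space `E` — in particular every real or complex normed space, where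
balls are convex — the assumption is unnecessary: the identity principle is applied on the
connected component of `e x` inside the chart target, which is open by local connectedness.
-/

namespace Summit.Ventures.HodgeRepro2.T5IdentityPrincipleGlobal

open Set Filter Topology

/-- A real normed space is locally connected: the balls are convex, hence connected, and they
form a neighbourhood basis (Mathlib `locallyConnectedSpace_of_connected_bases`). Through
`NormedSpace.complexToReal` this covers every complex normed space. -/
theorem locallyConnectedSpace_of_normedSpace_real {E : Type*} [NormedAddCommGroup E]
    [NormedSpace ℝ E] : LocallyConnectedSpace E :=
  locallyConnectedSpace_of_connected_bases (fun x ε => Metric.ball x ε) (fun _ ε => 0 < ε)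
    (fun _ => Metric.nhds_basis_ball) (fun x ε _ => (convex_ball x ε).isPreconnected)

section ChartComponent

variable {𝕜 : Type*} [NontriviallyNormedField 𝕜]
  {E : Type*} [NormedAddCommGroup E] [NormedSpace 𝕜 E]
  {F : Type*} [NormedAddCommGroup F] [NormedSpace 𝕜 F]
  {X : Type*} [TopologicalSpace X]

variable (e : OpenPartialHomeomorph X E)

/-- The part of the chart source lying over the connected component of `e t` in the target. -/
def sourceComponent (t : X) : Set X :=
  e.source ∩ e ⁻¹' connectedComponentIn e.target (e t)

/-- `sourceComponent e t` is open when the model space is locally connected. -/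
theorem isOpen_sourceComponent [LocallyConnectedSpace E] (t : X) :
    IsOpen (sourceComponent e t) :=
  e.continuousOn.isOpen_inter_preimage e.open_source (e.open_target.connectedComponentIn)

/-- `t` lies in `sourceComponent e t` when `t ∈ e.source`. -/
theorem mem_sourceComponent {t : X} (ht : t ∈ e.source) : t ∈ sourceComponent e t :=
  ⟨ht, mem_connectedComponentIn (e.map_source ht)⟩

/-- **The identity principle on one chart, any target.** If `f ∘ e.symm` is analytic on the
chart target and `f` vanishes near a point `t` of the source, then `f` vanishes on the part of
the source over the connected component of `e t` (Mathlib's identity principle applied on that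
component). No connectedness of the target is assumed. -/
theorem eqOn_zero_sourceComponent_of_eventuallyEq_zero {f : X → F}
    (hf : AnalyticOnNhd 𝕜 (f ∘ e.symm) e.target) {t : X} (ht : t ∈ e.source)
    (h : ∀ᶠ y in 𝓝 t, f y = 0) : EqOn f 0 (sourceComponent e t) := by
  have ht' : e t ∈ e.target := e.map_source ht
  have hC : IsPreconnected (connectedComponentIn e.target (e t)) :=
    isPreconnected_connectedComponentIn
  have hCsub : connectedComponentIn e.target (e t) ⊆ e.target := connectedComponentIn_subset _ _
  have h1 : (f ∘ e.symm) =ᶠ[𝓝 (e t)] 0 := by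
    have hc : ContinuousAt e.symm (e t) := e.continuousAt_symm ht'
    have h' : ∀ᶠ y in 𝓝 (e.symm (e t)), f y = 0 := by rwa [e.left_inv ht]
    filter_upwards [hc.eventually h'] with y hy using hy
  have h2 : EqOn (f ∘ e.symm) 0 (connectedComponentIn e.target (e t)) :=
    (hf.mono hCsub).eqOn_zero_of_preconnected_of_eventuallyEq_zero hC
      (mem_connectedComponentIn ht') h1
  intro z hz
  have h3 := h2 hz.2
  simpa [e.left_inv hz.1] using h3

end ChartComponent

section GlobalLocallyConnected

variable {𝕜 : Type*} [NontriviallyNormedField 𝕜]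
  {E : Type*} [NormedAddCommGroup E] [NormedSpace 𝕜 E] [LocallyConnectedSpace E]
  {F : Type*} [NormedAddCommGroup F] [NormedSpace 𝕜 F]
  {X : Type*} [TopologicalSpace X] [ChartedSpace E X]

/-- `locallyZero f` is closed for a chart-analytic `f` on a space modelled on a locally
connected `E` — no assumption on the chart targets. -/
theorem isClosed_locallyZero' {f : X → F}
    (hf : ∀ x : X, AnalyticOnNhd 𝕜 (f ∘ (chartAt E x).symm) (chartAt E x).target) :
    IsClosed (locallyZero f) := by
  rw [← closure_subset_iff_isClosed]
  intro x hx
  have hxs : x ∈ (chartAt E x).source := mem_chart_source E x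
  obtain ⟨t, hts, ht⟩ := (mem_closure_iff_nhds.mp hx) (sourceComponent (chartAt E x) x)
    ((isOpen_sourceComponent (chartAt E x) x).mem_nhds (mem_sourceComponent _ hxs))
  -- the component of `e t` is the component of `e x`
  have hcomp : connectedComponentIn (chartAt E x).target ((chartAt E x) t) =
      connectedComponentIn (chartAt E x).target ((chartAt E x) x) :=
    (connectedComponentIn_eq hts.2).symm
  have hz : EqOn f 0 (sourceComponent (chartAt E x) t) :=
    eqOn_zero_sourceComponent_of_eventuallyEq_zero (chartAt E x) (hf x) hts.1
      (mem_locallyZero.mp ht)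
  have hzx : EqOn f 0 (sourceComponent (chartAt E x) x) := by
    intro y hy
    exact hz ⟨hy.1, hcomp ▸ hy.2⟩
  exact subset_locallyZero_of_eqOn (isOpen_sourceComponent (chartAt E x) x) hzx
    (mem_sourceComponent _ hxs)

/-- **The identity principle on a connected charted space, any atlas.** For `X` connected and
modelled on a locally connected `E` (every real or complex normed space), a chart-analytic
function vanishing near one point vanishes identically. -/
theorem eq_zero_of_eventually_zero' [PreconnectedSpace X] {f : X → F}
    (hf : ∀ x : X, AnalyticOnNhd 𝕜 (f ∘ (chartAt E x).symm) (chartAt E x).target)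
    {x₀ : X} (h₀ : ∀ᶠ y in 𝓝 x₀, f y = 0) : ∀ x, f x = 0 := by
  have hcl : IsClopen (locallyZero f) := ⟨isClosed_locallyZero' hf, isOpen_locallyZero f⟩
  have huniv : locallyZero f = univ := hcl.eq_univ ⟨x₀, mem_locallyZero.mpr h₀⟩
  intro x
  exact eq_zero_of_mem_locallyZero (huniv ▸ mem_univ x)

/-- The «non-empty open set» form, any atlas. -/
theorem eq_zero_of_eqOn_zero_open' [PreconnectedSpace X] {f : X → F}
    (hf : ∀ x : X, AnalyticOnNhd 𝕜 (f ∘ (chartAt E x).symm) (chartAt E x).target)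
    {V : Set X} (hV : IsOpen V) (hne : V.Nonempty) (hfV : EqOn f 0 V) : ∀ x, f x = 0 := by
  obtain ⟨v, hv⟩ := hne
  exact eq_zero_of_eventually_zero' hf (mem_locallyZero.mp (subset_locallyZero_of_eqOn hV hfV hv))

/-- **H6 (i) ⟺ (iv), any atlas.** On a non-empty connected space modelled on a locally
connected `E`, a chart-analytic `f` is non-zero somewhere iff `{x | f x ≠ 0}` is dense. -/
theorem exists_ne_zero_iff_dense' [PreconnectedSpace X] [Nonempty X] {f : X → F}
    (hf : ∀ x : X, AnalyticOnNhd 𝕜 (f ∘ (chartAt E x).symm) (chartAt E x).target) :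
    (∃ x, f x ≠ 0) ↔ Dense {x | f x ≠ 0} := by
  constructor
  · rintro ⟨x₀, hx₀⟩
    rw [dense_iff_inter_open]
    intro V hV hne
    by_contra hempty
    have hfV : EqOn f 0 V := by
      intro v hv
      by_contra hfv
      exact hempty ⟨v, hv, hfv⟩
    exact hx₀ (eq_zero_of_eqOn_zero_open' hf hV hne hfV x₀)
  · intro hd
    obtain ⟨x, hx⟩ := hd.nonempty
    exact ⟨x, hx⟩

end GlobalLocallyConnected

section Complex

variable {E : Type*} [NormedAddCommGroup E] [NormedSpace ℂ E]
  {F : Type*} [NormedAddCommGroup F] [NormedSpace ℂ F]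
  {X : Type*} [TopologicalSpace X] [ChartedSpace E X]

/-- The complex case (`S_j` modelled on `ℂ²` with any holomorphic atlas): a holomorphic function
on a connected complex manifold vanishing near one point vanishes identically. -/
theorem eq_zero_of_eventually_zero_complex [PreconnectedSpace X] {f : X → F}
    (hf : ∀ x : X, AnalyticOnNhd ℂ (f ∘ (chartAt E x).symm) (chartAt E x).target)
    {x₀ : X} (h₀ : ∀ᶠ y in 𝓝 x₀, f y = 0) : ∀ x, f x = 0 :=
  haveI : LocallyConnectedSpace E := locallyConnectedSpace_of_normedSpace_real
  eq_zero_of_eventually_zero' hf h₀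

/-- The complex case of H6 (i) ⟺ (iv): on a non-empty connected complex manifold, a holomorphic
function is non-zero somewhere iff its non-vanishing set is dense. -/
theorem exists_ne_zero_iff_dense_complex [PreconnectedSpace X] [Nonempty X] {f : X → F}
    (hf : ∀ x : X, AnalyticOnNhd ℂ (f ∘ (chartAt E x).symm) (chartAt E x).target) :
    (∃ x, f x ≠ 0) ↔ Dense {x | f x ≠ 0} :=
  haveI : LocallyConnectedSpace E := locallyConnectedSpace_of_normedSpace_real
  exists_ne_zero_iff_dense' hf

end Complex

end Summit.Ventures.HodgeRepro2.T5IdentityPrincipleGlobal
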